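import Mathlib.Algebra.Homology.ShortComplex.ModuleCat
import Mathlib.Algebra.Homology.HomologySequence
import Literature.Algebra.Lie.ChevalleyEilenbergComplex
import HarnessLib

/-!
# The Chevalley–Eilenberg cohomology of a subcomplex is the homology of its `CochainComplex`

Topic `Algebra/Lie`; namespace `Literature.Algebra.Lie.ChevalleyEilenberg.Subcomplex`.
Definitions with bodies and theorems; no named fact, no `sorry`.  Companion of
`ChevalleyEilenbergComplex` (`Subcomplex.Cohomology`, `Subcomplex.toComplex`).

For a subcomplex `S` of the Chevalley–Eilenberg complex `C^•(L; M)` (`Subcomplex`; e.g. the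
relative complex `C^•(L, K; M)` or the `(𝔤, K)`-complex of `GKCohomology`), the tree defines its
cohomology `S.Cohomology q = Z^q / B^q` as an explicit quotient module and, separately, the
associated cochain complex of `R`-modules `S.toComplex : CochainComplex (ModuleCat R) ℕ`
(Mathlib `CochainComplex.of`).  This file identifies the two, so that Mathlib's homological
algebra (homology functor, long exact homology sequence of a short exact sequence of complexes,
`HomologicalComplex.HomologySequence`) applies to `H^•(L, K; M)` and `H^•(𝔤, K; V)`:

* `toComplex_X`, `toComplex_d`, `toComplex_d_zero_zero` — the objects and differentials of
  `S.toComplex` (`CochainComplex.of_d`);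
* `scSucc S q`, `scZero S` — the explicit short complexes `S_q → S_{q+1} → S_{q+2}` and
  `S_0 -0→ S_0 → S_1` (`ShortComplex.moduleCatMk`) with `isoScSucc`, `isoScZero` — they are the
  short complexes `S.toComplex.sc' …` of the complex (identity components);
* `cocyclesEquivKer` — `Z^q ≃ₗ ker (d|_{S_q})`; `cohomologyEquivSucc`, `cohomologyEquivZero` —
  `H^q(S) ≃ₗ ker / range` (Mathlib `ShortComplex.moduleCatLeftHomologyData`);
* `cohomologyEquiv S q : S.Cohomology q ≃ₗ[R] S.toComplex.homology q` — **the identification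
  with Mathlib's homology** (`ShortComplex.moduleCatHomologyIso`, `ShortComplex.homologyMapIso`,
  `HomologicalComplex.homologyIsoSc'`) [cite: ChevalleyEilenberg1948, §28 (the cohomology
  groups of a subcomplex)].

## Mathlib / Literature search

`CochainComplex.of_d`, `HomologicalComplex.sc'`/`isoSc'`/`homologyIsoSc'`,
`ShortComplex.moduleCatMk`, `moduleCatLeftHomologyData`, `moduleCatHomologyIso`,
`ShortComplex.homologyMapIso`, `ShortComplex.isoMk`, `CategoryTheory.Iso.toLinearEquiv`,
`Submodule.Quotient.equiv` (Mathlib; Mathlib's `Algebra/Lie/Cochain.lean` has low-degree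
cochains only).  No prior bridge in the tree (`lean search 'cohomologyEquiv|toComplex_d'`: no hits).

## References

* C. Chevalley, S. Eilenberg (1948), §23, §28 [ChevalleyEilenberg1948].
-/

noncomputable section

open CategoryTheory

namespace Literature.Algebra.Lie.ChevalleyEilenberg.Subcomplex

universe u v w

variable {R : Type u} [CommRing R] {L : Type v} [LieRing L] [LieAlgebra R L]
  {M : Type w} [AddCommGroup M] [Module R M] [LieRingModule L M] [LieModule R L M]
  (S : Subcomplex R L M)

/-- The objects of `S.toComplex` (definitional). [folklore] -/
theorem toComplex_X (q : ℕ) : S.toComplex.X q = ModuleCat.of R (S.carrier q) := rfl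

/-- The differentials of `S.toComplex`. [folklore] -/
theorem toComplex_d (q : ℕ) : S.toComplex.d q (q + 1) = ModuleCat.ofHom (S.dRes q) := by
  unfold toComplex
  exact CochainComplex.of_d (V := ModuleCat R) (fun q => ModuleCat.of R (S.carrier q))
    (fun q => ModuleCat.ofHom (S.dRes q)) q

/-- `d : S_0 → S_0` is zero (shape). [folklore] -/
theorem toComplex_d_zero_zero : S.toComplex.d 0 0 = 0 :=
  S.toComplex.shape 0 0 (by simp)

/-- The explicit short complex `S_q → S_{q+1} → S_{q+2}`. [folklore] -/
def scSucc (q : ℕ) : ShortComplex (ModuleCat R) :=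
  ShortComplex.moduleCatMk (S.dRes q) (S.dRes (q + 1)) (LinearMap.ext fun f => S.dRes_dRes q f)

/-- The explicit short complex `S_0 -0→ S_0 → S_1`. [folklore] -/
def scZero : ShortComplex (ModuleCat R) :=
  ShortComplex.moduleCatMk (0 : S.carrier 0 →ₗ[R] S.carrier 0) (S.dRes 0) (LinearMap.comp_zero _)

/-- `S.toComplex.sc' q (q+1) (q+2) ≅ scSucc q` (identity components). [folklore] -/
def isoScSucc (q : ℕ) : S.toComplex.sc' q (q + 1) (q + 2) ≅ S.scSucc q :=
  ShortComplex.isoMk (Iso.refl _) (Iso.refl _) (Iso.refl _)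
    (by
      change 𝟙 _ ≫ ModuleCat.ofHom (S.dRes q) = S.toComplex.d q (q + 1) ≫ 𝟙 _
      rw [Category.id_comp, Category.comp_id, toComplex_d])
    (by
      change 𝟙 _ ≫ ModuleCat.ofHom (S.dRes (q + 1)) = S.toComplex.d (q + 1) (q + 2) ≫ 𝟙 _
      rw [Category.id_comp, Category.comp_id, toComplex_d])

/-- `S.toComplex.sc' 0 0 1 ≅ scZero`. [folklore] -/
def isoScZero : S.toComplex.sc' 0 0 1 ≅ S.scZero :=
  ShortComplex.isoMk (Iso.refl _) (Iso.refl _) (Iso.refl _)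
    (by
      change 𝟙 _ ≫ ModuleCat.ofHom 0 = S.toComplex.d 0 0 ≫ 𝟙 _
      rw [Category.id_comp, Category.comp_id, toComplex_d_zero_zero]
      rfl)
    (by
      change 𝟙 _ ≫ ModuleCat.ofHom (S.dRes 0) = S.toComplex.d 0 1 ≫ 𝟙 _
      rw [Category.id_comp, Category.comp_id]
      exact (S.toComplex_d 0).symm)

/-- Cocycles as the kernel of the restricted differential. [folklore] -/
def cocyclesEquivKer (q : ℕ) : S.cocycles q ≃ₗ[R] LinearMap.ker (S.dRes q) where
  toFun z := ⟨⟨z, ((S.mem_cocycles_iff q _).1 z.2).1⟩,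
    Subtype.ext ((S.mem_cocycles_iff q _).1 z.2).2⟩
  invFun w := ⟨(w : S.carrier q), (S.mem_cocycles_iff q _).2 ⟨w.1.2, congrArg Subtype.val w.2⟩⟩
  map_add' _ _ := rfl
  map_smul' _ _ := rfl
  left_inv _ := rfl
  right_inv _ := rfl

/-- Unfolding. [folklore] -/
@[simp] theorem coe_coe_cocyclesEquivKer (q : ℕ) (z : S.cocycles q) :
    ((S.cocyclesEquivKer q z : S.carrier q) : Cochain R L M q) = z := rfl

/-- The tree's `H^{q+1}(S)` vs the explicit Mathlib homology module `ker / range`. [folklore] -/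
def cohomologyEquivSucc (q : ℕ) :
    S.Cohomology (q + 1) ≃ₗ[R] (S.scSucc q).moduleCatLeftHomologyData.H := by
  refine Submodule.Quotient.equiv _ _ (S.cocyclesEquivKer (q + 1)) ?_
  ext w
  simp only [Submodule.mem_map, Submodule.mem_comap, Submodule.subtype_apply,
    LinearMap.mem_range]
  constructor
  · rintro ⟨z, hz, rfl⟩
    obtain ⟨g, hg, hgz⟩ := (S.mem_coboundaries_succ_iff q _).1 hz
    refine ⟨⟨g, hg⟩, Subtype.ext (Subtype.ext ?_)⟩
    exact hgz
  · rintro ⟨g, rfl⟩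
    change ↥(S.carrier q) at g
    refine ⟨(S.cocyclesEquivKer (q + 1)).symm ((S.scSucc q).moduleCatToCycles g), ?_,
      LinearEquiv.apply_symm_apply _ _⟩
    exact (S.mem_coboundaries_succ_iff q _).2 ⟨(g : Cochain R L M q), g.2, rfl⟩

/-- The same in degree `0` (`B⁰ = 0`). [folklore] -/
def cohomologyEquivZero :
    S.Cohomology 0 ≃ₗ[R] S.scZero.moduleCatLeftHomologyData.H := by
  refine Submodule.Quotient.equiv _ _ (S.cocyclesEquivKer 0) ?_
  ext w
  simp only [Submodule.mem_map, Submodule.mem_comap, Submodule.subtype_apply,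
    LinearMap.mem_range]
  constructor
  · rintro ⟨z, hz, rfl⟩
    have hz0 : (z : Cochain R L M 0) = 0 := (Submodule.mem_bot R).1 hz
    refine ⟨0, ?_⟩
    rw [map_zero]
    refine Subtype.ext (Subtype.ext ?_)
    change (0 : Cochain R L M 0) = z
    exact hz0.symm
  · rintro ⟨g, rfl⟩
    refine ⟨0, Submodule.zero_mem _, ?_⟩
    rw [map_zero]
    exact Subtype.ext rfl

/-- **`H^q(S) ≃ₗ[R] H^q(S.toComplex)`**: the tree's quotient cohomology is Mathlib's homology of
the associated cochain complex of `R`-modules. [cite: ChevalleyEilenberg1948, §28] -/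
def cohomologyEquiv : (q : ℕ) → S.Cohomology q ≃ₗ[R] (S.toComplex.homology q : ModuleCat R)
  | 0 => S.cohomologyEquivZero ≪≫ₗ
      (S.scZero.moduleCatHomologyIso.symm ≪≫ ShortComplex.homologyMapIso S.isoScZero.symm ≪≫
        (S.toComplex.homologyIsoSc' 0 0 1 CochainComplex.prev_nat_zero
          (by simp)).symm).toLinearEquiv
  | q + 1 => S.cohomologyEquivSucc q ≪≫ₗ
      ((S.scSucc q).moduleCatHomologyIso.symm ≪≫ ShortComplex.homologyMapIso (S.isoScSucc q).symm ≪≫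
        (S.toComplex.homologyIsoSc' q (q + 1) (q + 2) (CochainComplex.prev_nat_succ q)
          (by simp)).symm).toLinearEquiv

end Literature.Algebra.Lie.ChevalleyEilenberg.Subcomplex
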